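import Summits.CriticalPhenomena.PercolationContinuityZ3.Theorems.PercNearOneGluingNoHeavyLowerTailSahiGridThreeCheckB

/-!
# `NoHeavyLowerTail` (crux stmt-CriticalPhenomena-4575), Sahi programme P1: the FINITE CERTIFICATE — tri-coefficient positivity of
# the three-copy pattern kernel on `[3]³`, part 3: last chunks, symmetry, and `sStar A B C ≥ 0` for all up-sets

Support file (Sahi cell, seat `prim-sahi-p1`, generation 6; `--supports stmt-CriticalPhenomena-4575`).  COMPUTATIONAL (`native_decide`)
like part 1; no `sorry`.

This file finishes the certificate of `…SahiGridThreeCheck{,B}`: chunks 5 and 6 of the sorted-triple check (first indices `[340, 495)`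
and `[495, 980)`), the symmetry of the trilinear coefficient table (`Ttab_symm`, hence `sStar` is a symmetric function of its three
arguments: `sStar_swap12`, `sStar_swap23`), and the assembled statement

* `sStar_nonneg_of_isUpperSet`: for all up-sets `A, B, C` of the small cube `Fin 3 → Fin 3`, `0 ≤ sStar A B C`

— the finite fact behind Sahi's `C₃` on every three-dimensional grid (`…SahiGridThree`). [this work]
-/

namespace Summit.CriticalPhenomena.PercolationContinuityZ3.Theorems.SahiGrid3

open Finset

/-! ### Chunks 5 and 6 -/

/-- THE CERTIFICATE, chunk 5: first indices `[340, 495)` (COMPUTATIONAL, `native_decide`). [this work] -/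
theorem checkChunk_5 : checkChunk 340 155 = true := by native_decide

/-- THE CERTIFICATE, chunk 6: first indices `[495, 980)` (COMPUTATIONAL, `native_decide`). [this work] -/
theorem checkChunk_6 : checkChunk 495 485 = true := by native_decide

/-- **All sorted index triples**: `0 ≤ sStar (U upVecs[i]) (U upVecs[j]) (U upVecs[k])` for `i ≤ j ≤ k < 980`. [this work] -/
theorem sStar_nonneg_sorted {i j k : ℕ} (hij : i ≤ j) (hjk : j ≤ k) (hk : k < upVecs.length) :
    0 ≤ sStar (U (upVecs[i]'(lt_of_le_of_lt (hij.trans hjk) hk))) (U (upVecs[j]'(lt_of_le_of_lt hjk hk))) (U (upVecs[k])) := by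
  have hi980 : i < 980 := by rw [← length_upVecs]; exact lt_of_le_of_lt (hij.trans hjk) hk
  by_cases h1 : i < 66
  · exact nonneg_of_checkChunk checkChunk_1 (Nat.zero_le _) (by omega) hij hjk hk
  by_cases h2 : i < 141
  · exact nonneg_of_checkChunk checkChunk_2 (by omega) (by omega) hij hjk hk
  by_cases h3 : i < 230
  · exact nonneg_of_checkChunk checkChunk_3 (by omega) (by omega) hij hjk hk
  by_cases h4 : i < 340
  · exact nonneg_of_checkChunk checkChunk_4 (by omega) (by omega) hij hjk hk
  by_cases h5 : i < 495
  · exact nonneg_of_checkChunk checkChunk_5 (by omega) (by omega) hij hjk hk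
  · exact nonneg_of_checkChunk checkChunk_6 (by omega) (by omega) hij hjk hk

/-! ### Symmetry of `sStar` -/

/-- The coefficient table is symmetric (COMPUTATIONAL, `native_decide`: `2·27³` table comparisons). [this work] -/
theorem Ttab_symm : ∀ x ∈ List.range 27, ∀ y ∈ List.range 27, ∀ z ∈ List.range 27,
    agetZ Ttab (x * 729 + y * 27 + z) = agetZ Ttab (y * 729 + x * 27 + z) ∧
      agetZ Ttab (x * 729 + y * 27 + z) = agetZ Ttab (x * 729 + z * 27 + y) := by
  have h : (let T := Ttab; (List.range 27).all fun x => (List.range 27).all fun y => (List.range 27).all fun z =>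
      agetZ T (x * 729 + y * 27 + z) == agetZ T (y * 729 + x * 27 + z) &&
        agetZ T (x * 729 + y * 27 + z) == agetZ T (x * 729 + z * 27 + y)) = true := by
    native_decide
  intro x hx y hy z hz
  simp only [List.all_eq_true] at h
  have h' := h x hx y hy z hz
  rw [Bool.and_eq_true, beq_iff_eq, beq_iff_eq] at h'
  exact h'

/-- `TI` is symmetric in its first two arguments (below `27`). [this work] -/
theorem TI_swap12 {x y z : ℕ} (hx : x < 27) (hy : y < 27) (hz : z < 27) : TI x y z = TI y x z := by
  rw [← Ttab_get hx hy hz, ← Ttab_get hy hx hz]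
  exact (Ttab_symm x (List.mem_range.2 hx) y (List.mem_range.2 hy) z (List.mem_range.2 hz)).1

/-- `TI` is symmetric in its last two arguments (below `27`). [this work] -/
theorem TI_swap23 {x y z : ℕ} (hx : x < 27) (hy : y < 27) (hz : z < 27) : TI x y z = TI x z y := by
  rw [← Ttab_get hx hy hz, ← Ttab_get hx hz hy]
  exact (Ttab_symm x (List.mem_range.2 hx) y (List.mem_range.2 hy) z (List.mem_range.2 hz)).2

/-- `sStar` through the index table. [this work] -/
theorem sStar_eq_sum_TI (A B C : Finset P3) :
    sStar A B C = ∑ x ∈ A, ∑ y ∈ B, ∑ z ∈ C, TI (pidx x) (pidx y) (pidx z) := by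
  rw [sStar_eq_sum_single]
  exact Finset.sum_congr rfl fun x _ => Finset.sum_congr rfl fun y _ => Finset.sum_congr rfl fun z _ => (TI_pidx x y z).symm

/-- **`sStar` is symmetric in its first two arguments.** [this work] -/
theorem sStar_swap12 (A B C : Finset P3) : sStar A B C = sStar B A C := by
  rw [sStar_eq_sum_TI, sStar_eq_sum_TI, Finset.sum_comm]
  exact Finset.sum_congr rfl fun y _ => Finset.sum_congr rfl fun x _ => Finset.sum_congr rfl fun z _ =>
    TI_swap12 (pidx_lt x) (pidx_lt y) (pidx_lt z)

/-- **`sStar` is symmetric in its last two arguments.** [this work] -/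
theorem sStar_swap23 (A B C : Finset P3) : sStar A B C = sStar A C B := by
  rw [sStar_eq_sum_TI, sStar_eq_sum_TI]
  refine Finset.sum_congr rfl fun x _ => ?_
  rw [Finset.sum_comm]
  exact Finset.sum_congr rfl fun z _ => Finset.sum_congr rfl fun y _ => TI_swap23 (pidx_lt x) (pidx_lt y) (pidx_lt z)

/-! ### Assembly -/

/-- From membership in `upVecs` to an index. [this work] -/
theorem exists_index {A : Finset P3} (hA : IsUpperSet (A : Set P3)) :
    ∃ i : ℕ, ∃ hi : i < upVecs.length, U (upVecs[i]) = A := by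
  obtain ⟨v, hv, hvA⟩ := exists_upVec hA
  obtain ⟨i, hi, rfl⟩ := List.getElem_of_mem hv
  exact ⟨i, hi, hvA⟩

/-- Sorted form with explicit sets. [this work] -/
theorem sStar_nonneg_idx {i j k : ℕ} (hi : i < upVecs.length) (hj : j < upVecs.length) (hk : k < upVecs.length)
    (hij : i ≤ j) (hjk : j ≤ k) : 0 ≤ sStar (U upVecs[i]) (U upVecs[j]) (U upVecs[k]) :=
  sStar_nonneg_sorted hij hjk hk

/-- **THE FINITE FACT: `sStar A B C ≥ 0` for all up-sets `A, B, C` of the small cube `[3]³`** (tri-coefficient positivity of Sahi's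
`E₃` on the `3×3×3` grid).  COMPUTATIONAL (rests on the `native_decide` chunks). [this work] -/
theorem sStar_nonneg_of_isUpperSet {A B C : Finset P3} (hA : IsUpperSet (A : Set P3)) (hB : IsUpperSet (B : Set P3))
    (hC : IsUpperSet (C : Set P3)) : 0 ≤ sStar A B C := by
  obtain ⟨i, hi, rfl⟩ := exists_index hA
  obtain ⟨j, hj, rfl⟩ := exists_index hB
  obtain ⟨k, hk, rfl⟩ := exists_index hC
  -- sort the three indices using the symmetry of `sStar`
  rcases le_total i j with hij | hji
  · rcases le_total j k with hjk | hkj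
    · exact sStar_nonneg_idx hi hj hk hij hjk
    · rcases le_total i k with hik | hki
      · rw [sStar_swap23]; exact sStar_nonneg_idx hi hk hj hik hkj
      · rw [sStar_swap23, sStar_swap12]; exact sStar_nonneg_idx hk hi hj hki hij
  · rcases le_total i k with hik | hki
    · rw [sStar_swap12]; exact sStar_nonneg_idx hj hi hk hji hik
    · rcases le_total j k with hjk | hkj
      · rw [sStar_swap12, sStar_swap23]; exact sStar_nonneg_idx hj hk hi hjk hki
      · rw [sStar_swap23, sStar_swap12, sStar_swap23]; exact sStar_nonneg_idx hk hj hi hkj hji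

end Summit.CriticalPhenomena.PercolationContinuityZ3.Theorems.SahiGrid3
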